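import Mathlib
import Summits.Ventures.PercRepro2.Defs
import Summits.Ventures.PercRepro2.Independence
import Summits.Ventures.PercRepro2.Harris
import Summits.Ventures.PercRepro2.Exploration
import Summits.Ventures.PercRepro2.FourFunctions
import Summits.Ventures.PercRepro2.Frontier
import Summits.Ventures.PercRepro2.CoinDefs
import Summits.Ventures.PercRepro2.CoinInduced
import Summits.Ventures.PercRepro2.CoinFrontier

/-!
# The van den Berg–Kahn inequality for MIXED coin systems (blind cell PercRepro2, night-2)

Directed van den Berg–Kahn (Ann. Probab. 29 (2001) 123–126, Theorem 1.2) on a coin system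
`arcs : E → Finset (V × V)` with `SameEnds arcs` (every two arcs of a coin have the same endpoint
set: single arcs, antiparallel pairs — the MIXED systems of row 2′DARC; `CoinScope.lean` shows the
statement FAILS for general arc-set coins, NEG-80): for a root `s`, with `Q_A = {s ⇝ a ∀ a ∈ A}`
(forward reachability along open arcs) and `R_X = {s ↛ x ∀ x ∈ X}`,

  `P(Q_A ∩ R_X) · P(Q_B ∩ R_Y) ≤ P(Q_{A∪B} ∩ R_{X∩Y}) · P(R_{X∪Y})`.

The proof is the cell's exploration induction (`VdBKahn.lean`, p1) read backwards: induction on the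
vertex set `U` of the induced system; if `Z = X ∩ Y = ∅` the inequality is Harris twice; otherwise
explore the IN-coins of `Z`: the in-frontier `frontierC` reduces every term to percolation on
`D[U ∖ Z]` with the frontier added to the avoided set (`prob_QEventC_inter_REventC_union`,
`CoinFrontier.lean`), and the four functions theorem on the lattice `Config E` (the weight is
log-modular) with the induction hypothesis on `U ∖ Z` and `S(ω ⊔ ω') = S(ω) ∪ S(ω')`,
`S(ω ⊓ ω') ⊆ S(ω) ∩ S(ω')` closes the step.  Nothing undirected is used: this is the directed
vdBK/BHK induction of MINEC-GATE.md §6 (the "one new ingredient" for the coin-system gate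
theorems), now in the kernel.  Corollaries: `covC_nonneg` (directed BHK 1.3 for the point markers
given an avoidance event) and `shift_avoid_more_C` (monotonicity of the conditional mean in the
avoided set) — the four hypotheses of `darc_of_sink` / `darc_of_pendant` / `darc_of_path`.
-/

namespace Summit.Ventures.PercRepro2.Coin

section VdBKC

variable {V : Type*} {E : Type*} [Fintype E] [DecidableEq E] [Fintype V] [DecidableEq V]
  {R : Type*} [CommRing R] [LinearOrder R] [IsStrictOrderedRing R]

omit [Fintype V] in
/-- The case `X ∩ Y = ∅` of directed van den Berg–Kahn: Harris' inequality applied twice. -/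
lemma vdBKC_induced_of_inter_eq_empty (p : E → R) (hp : IsProbVec p) (arcs : E → Finset (V × V))
    (s : V) (U A B X Y : Finset V) (hZ : X ∩ Y = ∅) :
    prob p (QEventC arcs U s A ∩ REventC arcs U s X) *
        prob p (QEventC arcs U s B ∩ REventC arcs U s Y) ≤
      prob p (QEventC arcs U s (A ∪ B) ∩ REventC arcs U s (X ∩ Y)) *
        prob p (REventC arcs U s (X ∪ Y)) := by
  rw [hZ, REventC_empty, Set.inter_univ, QEventC_union, REventC_union]
  have hQA := isUpperSet_QEventC arcs U s A
  have hQB := isUpperSet_QEventC arcs U s B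
  have hRX := isLowerSet_REventC arcs U s X
  have hRY := isLowerSet_REventC arcs U s Y
  have h1 : prob p (QEventC arcs U s A ∩ REventC arcs U s X) ≤
      prob p (QEventC arcs U s A) * prob p (REventC arcs U s X) := by
    rw [Set.inter_comm, mul_comm]
    exact prob_inter_le_prob_mul_prob_of_isLowerSet hp hRX hQA
  have h2 : prob p (QEventC arcs U s B ∩ REventC arcs U s Y) ≤
      prob p (QEventC arcs U s B) * prob p (REventC arcs U s Y) := by
    rw [Set.inter_comm, mul_comm]
    exact prob_inter_le_prob_mul_prob_of_isLowerSet hp hRY hQB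
  have h3 := prob_mul_prob_le_prob_inter hp hQA hQB
  have h4 := prob_mul_prob_le_prob_inter_of_isLowerSet hp hRX hRY
  calc prob p (QEventC arcs U s A ∩ REventC arcs U s X) *
        prob p (QEventC arcs U s B ∩ REventC arcs U s Y)
      ≤ (prob p (QEventC arcs U s A) * prob p (REventC arcs U s X)) *
          (prob p (QEventC arcs U s B) * prob p (REventC arcs U s Y)) :=
        mul_le_mul h1 h2 (prob_nonneg hp _) (mul_nonneg (prob_nonneg hp _) (prob_nonneg hp _))
    _ = (prob p (QEventC arcs U s A) * prob p (QEventC arcs U s B)) *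
          (prob p (REventC arcs U s X) * prob p (REventC arcs U s Y)) := by ring
    _ ≤ prob p (QEventC arcs U s A ∩ QEventC arcs U s B) *
          prob p (REventC arcs U s X ∩ REventC arcs U s Y) :=
        mul_le_mul h3 h4 (mul_nonneg (prob_nonneg hp _) (prob_nonneg hp _)) (prob_nonneg hp _)

/-- **Directed van den Berg–Kahn on induced coin systems** (`SameEnds`): for every vertex set `U`
and all `A, B, X, Y` with `X, Y ⊆ U`,
`P(Q^U_A ∩ R^U_X) · P(Q^U_B ∩ R^U_Y) ≤ P(Q^U_{A∪B} ∩ R^U_{X∩Y}) · P(R^U_{X∪Y})`. -/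
theorem vdBKC_induced (p : E → R) (hp : IsProbVec p) {arcs : E → Finset (V × V)}
    (hS : SameEnds arcs) (s : V) (U : Finset V) :
    ∀ A B X Y : Finset V, X ⊆ U → Y ⊆ U →
      prob p (QEventC arcs U s A ∩ REventC arcs U s X) *
          prob p (QEventC arcs U s B ∩ REventC arcs U s Y) ≤
        prob p (QEventC arcs U s (A ∪ B) ∩ REventC arcs U s (X ∩ Y)) *
          prob p (REventC arcs U s (X ∪ Y)) := by
  induction U using Finset.strongInduction with
  | H U ih =>
  intro A B X Y hX hY
  by_cases hZ : X ∩ Y = ∅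
  · exact vdBKC_induced_of_inter_eq_empty p hp arcs s U A B X Y hZ
  -- the exploration step: `Z = X ∩ Y ≠ ∅`
  set Z := X ∩ Y with hZdef
  have hZX : Z ⊆ X := Finset.inter_subset_left
  have hZY : Z ⊆ Y := Finset.inter_subset_right
  have hZU : Z ⊆ U := hZX.trans hX
  by_cases hsZ : s ∈ Z
  · -- `s ∈ X`: the left side vanishes
    rw [REventC_eq_empty_of_mem arcs U (hZX hsZ), Set.inter_empty, prob_empty, zero_mul]
    exact mul_nonneg (prob_nonneg hp _) (prob_nonneg hp _)
  have hU' : U \ Z ⊂ U := Finset.sdiff_ssubset hZU (Finset.nonempty_iff_ne_empty.2 hZ)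
  -- the four terms as sums over configurations (domain Markov identity)
  have e1 : prob p (QEventC arcs U s A ∩ REventC arcs U s X) =
      ∑ ω, weight p ω * prob p (QEventC arcs (U \ Z) s A ∩
        REventC arcs (U \ Z) s ((X \ Z) ∪ frontierC arcs U Z ω)) := by
    rw [← prob_QEventC_inter_REventC_union p hS hZU hsZ A (X \ Z),
      Finset.sdiff_union_of_subset hZX]
  have e2 : prob p (QEventC arcs U s B ∩ REventC arcs U s Y) =
      ∑ ω, weight p ω * prob p (QEventC arcs (U \ Z) s B ∩
        REventC arcs (U \ Z) s ((Y \ Z) ∪ frontierC arcs U Z ω)) := by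
    rw [← prob_QEventC_inter_REventC_union p hS hZU hsZ B (Y \ Z),
      Finset.sdiff_union_of_subset hZY]
  have e3 : prob p (QEventC arcs U s (A ∪ B) ∩ REventC arcs U s Z) =
      ∑ ω, weight p ω * prob p (QEventC arcs (U \ Z) s (A ∪ B) ∩
        REventC arcs (U \ Z) s (∅ ∪ frontierC arcs U Z ω)) := by
    rw [← prob_QEventC_inter_REventC_union p hS hZU hsZ (A ∪ B) ∅, Finset.empty_union]
  have e4 : prob p (REventC arcs U s (X ∪ Y)) =
      ∑ ω, weight p ω * prob p (QEventC arcs (U \ Z) s ∅ ∩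
        REventC arcs (U \ Z) s (((X \ Z) ∪ (Y \ Z)) ∪ frontierC arcs U Z ω)) := by
    rw [← prob_QEventC_inter_REventC_union p hS hZU hsZ ∅ ((X \ Z) ∪ (Y \ Z)), QEventC_empty,
      Set.univ_inter, ← Finset.union_sdiff_distrib,
      Finset.sdiff_union_of_subset (hZX.trans Finset.subset_union_left)]
  rw [e1, e2, e3, e4]
  -- the four functions theorem on the lattice `Config E`
  refine four_functions_theorem_univ
    (fun ω => weight p ω * prob p (QEventC arcs (U \ Z) s A ∩
      REventC arcs (U \ Z) s ((X \ Z) ∪ frontierC arcs U Z ω)))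
    (fun ω => weight p ω * prob p (QEventC arcs (U \ Z) s B ∩
      REventC arcs (U \ Z) s ((Y \ Z) ∪ frontierC arcs U Z ω)))
    (fun ω => weight p ω * prob p (QEventC arcs (U \ Z) s (A ∪ B) ∩
      REventC arcs (U \ Z) s (∅ ∪ frontierC arcs U Z ω)))
    (fun ω => weight p ω * prob p (QEventC arcs (U \ Z) s ∅ ∩
      REventC arcs (U \ Z) s (((X \ Z) ∪ (Y \ Z)) ∪ frontierC arcs U Z ω)))
    (fun ω => mul_nonneg (weight_nonneg hp ω) (prob_nonneg hp _))
    (fun ω => mul_nonneg (weight_nonneg hp ω) (prob_nonneg hp _))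
    (fun ω => mul_nonneg (weight_nonneg hp ω) (prob_nonneg hp _))
    (fun ω => mul_nonneg (weight_nonneg hp ω) (prob_nonneg hp _)) ?_
  intro ω ω'
  -- induction hypothesis on `U ∖ Z` with the in-frontiers added to the avoided sets
  have hX'' : (X \ Z) ∪ frontierC arcs U Z ω ⊆ U \ Z :=
    Finset.union_subset (Finset.sdiff_subset_sdiff hX (le_refl Z)) (frontierC_subset ω)
  have hY'' : (Y \ Z) ∪ frontierC arcs U Z ω' ⊆ U \ Z :=
    Finset.union_subset (Finset.sdiff_subset_sdiff hY (le_refl Z)) (frontierC_subset ω')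
  have hIH := ih (U \ Z) hU' A B ((X \ Z) ∪ frontierC arcs U Z ω)
    ((Y \ Z) ∪ frontierC arcs U Z ω') hX'' hY''
  -- `S(ω ⊓ ω') ⊆ S(ω) ∩ S(ω') ⊆ X'' ∩ Y''`
  have h3 : prob p (QEventC arcs (U \ Z) s (A ∪ B) ∩ REventC arcs (U \ Z) s
      (((X \ Z) ∪ frontierC arcs U Z ω) ∩ ((Y \ Z) ∪ frontierC arcs U Z ω'))) ≤
      prob p (QEventC arcs (U \ Z) s (A ∪ B) ∩
        REventC arcs (U \ Z) s (∅ ∪ frontierC arcs U Z (ω ⊓ ω'))) := by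
    refine prob_mono hp (Set.inter_subset_inter_right _ (REventC_anti _ _ _ ?_))
    rw [Finset.empty_union]
    exact (frontierC_inf_subset ω ω').trans
      (Finset.inter_subset_inter Finset.subset_union_right Finset.subset_union_right)
  -- `X'' ∪ Y'' = (X' ∪ Y') ∪ S(ω ⊔ ω')`
  have h4 : prob p (REventC arcs (U \ Z) s
      (((X \ Z) ∪ frontierC arcs U Z ω) ∪ ((Y \ Z) ∪ frontierC arcs U Z ω'))) =
      prob p (QEventC arcs (U \ Z) s ∅ ∩
        REventC arcs (U \ Z) s (((X \ Z) ∪ (Y \ Z)) ∪ frontierC arcs U Z (ω ⊔ ω'))) := by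
    rw [QEventC_empty, Set.univ_inter, frontierC_sup]
    congr 2
    ext x
    simp only [Finset.mem_union]
    tauto
  calc weight p ω * prob p (QEventC arcs (U \ Z) s A ∩
          REventC arcs (U \ Z) s ((X \ Z) ∪ frontierC arcs U Z ω)) *
        (weight p ω' * prob p (QEventC arcs (U \ Z) s B ∩
          REventC arcs (U \ Z) s ((Y \ Z) ∪ frontierC arcs U Z ω')))
      = (weight p ω * weight p ω') *
          (prob p (QEventC arcs (U \ Z) s A ∩
            REventC arcs (U \ Z) s ((X \ Z) ∪ frontierC arcs U Z ω)) *
          prob p (QEventC arcs (U \ Z) s B ∩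
            REventC arcs (U \ Z) s ((Y \ Z) ∪ frontierC arcs U Z ω'))) := by ring
    _ ≤ (weight p ω * weight p ω') *
          (prob p (QEventC arcs (U \ Z) s (A ∪ B) ∩
            REventC arcs (U \ Z) s (∅ ∪ frontierC arcs U Z (ω ⊓ ω'))) *
          prob p (QEventC arcs (U \ Z) s ∅ ∩
            REventC arcs (U \ Z) s (((X \ Z) ∪ (Y \ Z)) ∪ frontierC arcs U Z (ω ⊔ ω')))) :=
        mul_le_mul_of_nonneg_left
          (hIH.trans (mul_le_mul h3 (le_of_eq h4) (prob_nonneg hp _) (prob_nonneg hp _)))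
          (mul_nonneg (weight_nonneg hp ω) (weight_nonneg hp ω'))
    _ = weight p (ω ⊓ ω') * prob p (QEventC arcs (U \ Z) s (A ∪ B) ∩
          REventC arcs (U \ Z) s (∅ ∪ frontierC arcs U Z (ω ⊓ ω'))) *
        (weight p (ω ⊔ ω') * prob p (QEventC arcs (U \ Z) s ∅ ∩
          REventC arcs (U \ Z) s (((X \ Z) ∪ (Y \ Z)) ∪ frontierC arcs U Z (ω ⊔ ω')))) := by
        rw [← weight_inf_mul_weight_sup p ω ω']
        ring

end VdBKC

/-! ## The theorem on the whole coin system -/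

section Whole

variable {V : Type*} {E : Type*} [Fintype E] [DecidableEq E] [Fintype V] [DecidableEq V]
  {R : Type*} [CommRing R] [LinearOrder R] [IsStrictOrderedRing R]

/-- `{s ⇝ a for all a ∈ A}` in the whole coin system. -/
def connAllC (arcs : E → Finset (V × V)) (s : V) (A : Finset V) : Set (Config E) :=
  {ω | ∀ a ∈ A, Reach arcs ω s a}

omit [Fintype E] [DecidableEq E] [DecidableEq V] in
/-- `Q^{univ}_A` is the whole-system event. -/
lemma QEventC_univ' (arcs : E → Finset (V × V)) (s : V) (A : Finset V) :
    QEventC arcs Finset.univ s A = connAllC arcs s A :=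
  QEventC_univ arcs s A

omit [Fintype E] [DecidableEq E] [Fintype V] [DecidableEq V] in
/-- `connAllC {a} = fwdEvent a`. -/
lemma connAllC_singleton (arcs : E → Finset (V × V)) (s a : V) :
    connAllC arcs s {a} = fwdEvent arcs s a := by
  ext ω; simp [connAllC, fwdEvent]

omit [Fintype E] [DecidableEq E] [Fintype V] [DecidableEq V] in
/-- `connAllC ∅` is the sure event. -/
lemma connAllC_empty (arcs : E → Finset (V × V)) (s : V) :
    connAllC arcs s ∅ = Set.univ := by
  ext ω; simp [connAllC]

omit [Fintype E] [DecidableEq E] [Fintype V] in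
/-- `connAllC (A ∪ B) = connAllC A ∩ connAllC B`. -/
lemma connAllC_union (arcs : E → Finset (V × V)) (s : V) (A B : Finset V) :
    connAllC arcs s (A ∪ B) = connAllC arcs s A ∩ connAllC arcs s B := by
  ext ω
  simp only [connAllC, Set.mem_setOf_eq, Set.mem_inter_iff, Finset.mem_union, or_imp, forall_and]

/-- **Directed van den Berg–Kahn, Theorem 1.2, for MIXED coin systems** (`SameEnds`): for a root
`s` and vertex sets `A, B, X, Y`,
`P(Q_A ∩ R_X) · P(Q_B ∩ R_Y) ≤ P(Q_{A∪B} ∩ R_{X∩Y}) · P(R_{X∪Y})`, where `Q_A = {s ⇝ a ∀ a ∈ A}`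
(`connAllC`) and `R_X = {s ↛ x ∀ x ∈ X}` (`avoidEvent`). -/
theorem vdBKC (p : E → R) (hp : IsProbVec p) {arcs : E → Finset (V × V)} (hS : SameEnds arcs)
    (s : V) (A B X Y : Finset V) :
    prob p (connAllC arcs s A ∩ avoidEvent arcs s X) *
        prob p (connAllC arcs s B ∩ avoidEvent arcs s Y) ≤
      prob p (connAllC arcs s (A ∪ B) ∩ avoidEvent arcs s (X ∩ Y)) *
        prob p (avoidEvent arcs s (X ∪ Y)) := by
  have h := vdBKC_induced p hp hS s Finset.univ A B X Y (Finset.subset_univ X)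
    (Finset.subset_univ Y)
  simpa only [QEventC_univ', REventC_univ] using h

end Whole

/-! ## The four directed-BHK facts used by the sink / pendant / path theorems -/

section Facts

variable {V : Type*} {E : Type*} [Fintype E] [DecidableEq E] [Fintype V] [DecidableEq V]
  {R : Type*} [CommRing R] [LinearOrder R] [IsStrictOrderedRing R]

open Classical in
omit [Fintype V] [DecidableEq V] [LinearOrder R] [IsStrictOrderedRing R] in
/-- `E[X; 𝒟] = P({a ∈ S⁺} ∩ 𝒟)` for the marker `X = 1[a ∈ S⁺]`. -/
lemma massE_marker_eq_prob (p : E → R) (arcs : E → Finset (V × V)) (s a : V)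
    (D : Set (Config E)) :
    massE p (marker (R := R) arcs s a) D = prob p (fwdEvent arcs s a ∩ D) := by
  unfold massE expect prob
  refine Finset.sum_congr rfl fun ω _ => ?_
  by_cases hD : ω ∈ D
  · rw [Set.indicator_of_mem hD]
    by_cases ha : Reach arcs ω s a
    · have hm : ω ∈ fwdEvent arcs s a ∩ D := Set.mem_inter ha hD
      rw [Set.indicator_of_mem hm]
      simp only [marker, if_pos ha, mul_one]
    · have hm : ω ∉ fwdEvent arcs s a ∩ D := fun h => ha h.1
      rw [Set.indicator_of_notMem hm]
      simp only [marker, if_neg ha, mul_zero]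
  · rw [Set.indicator_of_notMem hD, Set.indicator_of_notMem (fun h => hD h.2), mul_zero]

open Classical in
omit [Fintype V] [DecidableEq V] [LinearOrder R] [IsStrictOrderedRing R] in
/-- `E[XY; 𝒟] = P({a ∈ S⁺} ∩ {b ∈ S⁺} ∩ 𝒟)`. -/
lemma massE_marker_mul_eq_prob (p : E → R) (arcs : E → Finset (V × V)) (s a b : V)
    (D : Set (Config E)) :
    massE p (fun ω => marker (R := R) arcs s a ω * marker (R := R) arcs s b ω) D =
      prob p (fwdEvent arcs s a ∩ fwdEvent arcs s b ∩ D) := by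
  unfold massE expect prob
  refine Finset.sum_congr rfl fun ω _ => ?_
  by_cases hD : ω ∈ D
  · rw [Set.indicator_of_mem hD]
    by_cases ha : Reach arcs ω s a
    · by_cases hb : Reach arcs ω s b
      · have hm : ω ∈ fwdEvent arcs s a ∩ fwdEvent arcs s b ∩ D :=
          Set.mem_inter (Set.mem_inter ha hb) hD
        rw [Set.indicator_of_mem hm]
        simp only [marker, if_pos ha, if_pos hb, mul_one]
      · have hm : ω ∉ fwdEvent arcs s a ∩ fwdEvent arcs s b ∩ D := fun h => hb h.1.2
        rw [Set.indicator_of_notMem hm]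
        simp only [marker, if_pos ha, if_neg hb, mul_zero]
    · have hm : ω ∉ fwdEvent arcs s a ∩ fwdEvent arcs s b ∩ D := fun h => ha h.1.1
      rw [Set.indicator_of_notMem hm]
      simp only [marker, if_neg ha, zero_mul, mul_zero]
  · rw [Set.indicator_of_notMem hD, Set.indicator_of_notMem (fun h => hD h.2), mul_zero]

/-- **Directed BHK 1.3 for the point markers** on a `SameEnds` coin system: the cleared
conditional covariance of `X = 1[a ∈ S⁺]`, `Y = 1[b ∈ S⁺]` on any avoidance event `R_X` is
nonnegative, `covC p arcs s a b (avoidEvent arcs s X) ≥ 0`. -/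
theorem covC_nonneg (p : E → R) (hp : IsProbVec p) {arcs : E → Finset (V × V)}
    (hS : SameEnds arcs) (s a b : V) (X : Finset V) :
    0 ≤ covC p arcs s a b (avoidEvent arcs s X) := by
  have h := vdBKC p hp hS s {a} {b} X X
  rw [Finset.inter_self, Finset.union_self, connAllC_union, connAllC_singleton,
    connAllC_singleton] at h
  simp only [covC]
  rw [massE_marker_eq_prob, massE_marker_eq_prob, massE_marker_mul_eq_prob]
  linarith [h, mul_comm (prob p (fwdEvent arcs s a ∩ fwdEvent arcs s b ∩ avoidEvent arcs s X))
    (prob p (avoidEvent arcs s X))]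

/-- **Monotonicity of the conditional mean in the avoided set** (cleared): for `U ⊆ U'`,
`E[X; R_{U'}] · P(R_U) ≤ E[X; R_U] · P(R_{U'})` — the Lemma A shift, directed. -/
theorem shift_avoid_more_C (p : E → R) (hp : IsProbVec p) {arcs : E → Finset (V × V)}
    (hS : SameEnds arcs) (s a : V) {U U' : Finset V} (hU : U ⊆ U') :
    massE p (marker (R := R) arcs s a) (avoidEvent arcs s U') * prob p (avoidEvent arcs s U) ≤
      massE p (marker (R := R) arcs s a) (avoidEvent arcs s U) *
        prob p (avoidEvent arcs s U') := by
  have h := vdBKC p hp hS s {a} ∅ U' U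
  have h1 : U' ∩ U = U := Finset.inter_eq_right.2 hU
  have h2 : U' ∪ U = U' := Finset.union_eq_left.2 hU
  rw [h1, h2, Finset.union_empty, connAllC_empty, Set.univ_inter, connAllC_singleton] at h
  rw [massE_marker_eq_prob, massE_marker_eq_prob]
  exact h

end Facts

end Summit.Ventures.PercRepro2.Coin
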